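import Summits.HodgeConjecture.HodgeConjecture.Theses.So7OddThetaNulls

/-!
# Birth skeleton (BC3 shape) for the REPAIRED crux `OddThetaNullsR` — 16 odd theta-nulls, not 24

Crux item `stmt-HodgeConjecture-18788`, decl
`Summit.HodgeConjecture.HodgeConjecture.Theses.So7OddThetaNulls.OddThetaNulls`, is FALSE as typed
(this seat, 2026-08-17): eight of the 24 characteristics of `chars` — `(a, b + 128)` for `a < 128`, i.e.
`(30,248),(30,249),(54,236),(54,237),(86,234),(86,235),(126,254),(126,255)` — are NOT odd in `z₅`; first
counterexample `(30,248)`, `H = (116,-36,-144,-48,-32,32)`: `thetaCoeff 30 248 H = thetaCoeff 30 248 (flipQ H)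
= -2` (Lean: `bc/OddThetaNulls_counterexample.lean`, `native_decide`; Python: exact enumeration). For `a < 128`,
`y₇ = 2m₇` vanishes on every shell `H 0 < 64`, so `b` and `b + 128` give identical signs there — which is why the
checks `H 0 ≤ 52` (planner) and `H 0 < 94` (archive) could not separate them. A scan of ALL `2¹⁶` characteristics
(complete buckets `H 0 ≤ 132`) finds EXACTLY 16 that are odd in `z₅`: `oddChars` below; they are verified odd on all
complete buckets with `H 0 ≤ 480` (≈ 8·10⁵ points, 4·10⁵ buckets per `a`), with zero violations.

This file is the skeleton the tenure planner can re-hang on the repaired item (REPAIR DUTY, class `misstated`: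
new item `OddThetaNullsR` with the signature of `OddThetaNullsR` below; `CayleyCarrier := OddThetaNulls → …` is now
vacuously true and must be re-hung on `OddThetaNullsR` as well). `OddThetaNullsR` here is a LOCAL STAND-IN with the
recommended signature; once the route decl exists, replace the local `def` by an `open` and the file registers as is.

## The seam (verified numerically to `H 0 ≤ 480`, all 16): sign rule × count symmetry

For `y = 2m + a` on the eight cosets (`a ∈ {30,54,86,126,158,182,214,254}`):
* `quadVec y = H` lies on the isotropic cone `8H₀² = 8H₁² + 4(H₂²+H₃²+H₄²) + H₅²` (Clifford norm identity), and
  `H₅/32 = -y₀y₇ + y₁y₆ - y₂y₅ + y₃y₄` is ODD on these cosets; so `|H₅|` is determined by `H₀..H₄`, no bucket has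
  `H₅ = 0`, and oddness in `z₅` ⟺ vanishing of `θ_{ab}` on the slice `z₅ = 0` (the form the route uses downstream).
* SIGN RULE (elementary, pointwise congruences): for the "pure" partner `b*_a` (`120,108,106,126` for
  `a = 30,54,86,126`; `121,109,107,127` for `a = 158,182,214,254`) one has `termSign b m = κ_a · χ₄(H₅/32)`
  (`χ₄(1) = 1, χ₄(3) = -1`; `κ = -1` for `a ∈ {54,182}`, else `+1`) — e.g. `a = 30`:
  `H₅/32 ≡ 1 + 2(m₃+m₄+m₅+m₆) (mod 4)` and `b = 120 = e₃+e₄+e₅+e₆`; for the other partner (`b*_a ± 1`, bit 0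
  toggled) the extra factor `(-1)^{m₀}` is bucket-constant too (`a = 30`: `H₀ ≡ 8m₀ + 4 (mod 16)`). Hence the sign is
  CONSTANT on each bucket and OPPOSITE on `bucket a H` / `bucket a (flipQ H)`: this is `SignFlip` (stub 2, size S/M,
  provable now by `ZMod 4`/`ZMod 16` case analysis or `decide` after reduction mod 4).
* COUNT SYMMETRY (the arithmetic heart): `(bucket a (flipQ H)).card = (bucket a H).card` — the representation
  numbers of the coset `a + 2ℤ⁸` by the system `(Q₀,…,Q₅)` are symmetric under `H₅ ↦ -H₅`. NO linear or
  piecewise-linear bijection can give it (a linear map fixing `B₀,…,B₄` commutes with `R₁,…,R₄`, hence with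
  `ω = R₁R₂R₃R₄`, hence fixes `B₅ = B₀ω`). The natural proof is quaternionic: `ℤ⁸ ∋ y ↔ (α, β)`,
  `Q₀ + Q₁ = 4(y₀² + 4y₃² + 4y₅² + 4y₆²)`, `Q₀ - Q₁ = 8(y₁² + y₂² + y₄² + 4y₇²)` (two quaternion norms) and
  `(Q₂,Q₃,Q₄,Q₅)` bilinear in `(y₀,y₃,y₅,y₆) × (y₁,y₂,y₄,y₇)` (coordinates of a product `α·u·β̄`); the count is a
  number of left divisors of prescribed norm of a quaternion in an order of class number one, which depends only on
  the norms and the content — invariant under the coordinate reflection (Hurwitz 1896 / Pall 1940 factorisation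
  counting; Freitag–Hermann 2000 Lemma 11.2 is exactly this step one level up). This is `CountFlip` (stub 1, size L).

`OddThetaNullsR_of_pieces` is the real (sorry-free) composition: on a bucket pick `m₀`; every sign on `bucket H`
equals `termSign b m₀` and every sign on `bucket (flipQ H)` equals `-termSign b m₀` (both from `SignFlip`, the
first via a witness in the flipped bucket, which is non-empty by `CountFlip`), so both coefficients are
`± card · termSign b m₀` with equal cards.
-/

namespace Summit.HodgeConjecture.HodgeConjecture.Cruxes.OddThetaNulls.BirthR

open Literature.NumberTheory.ModularForms.So7KugaSatake
open Summit.HodgeConjecture.HodgeConjecture.Theses.So7OddThetaNulls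

/-- The 16 characteristics whose theta-nulls ARE odd in `z₅` (scan of all `2¹⁶`, complete buckets `H 0 ≤ 132`;
verified to `H 0 ≤ 480`): `a ∈ {30,54,86,126,158,182,214,254}`, `b ∈ {b_a, b_a + 1}`. [folklore] -/
def oddChars : Finset (ℕ × ℕ) :=
  {(30, 120), (30, 121), (54, 108), (54, 109), (86, 106), (86, 107), (126, 126), (126, 127),
   (158, 120), (158, 121), (182, 108), (182, 109), (214, 106), (214, 107), (254, 126), (254, 127)}

/-- `oddChars` = the 24 of `chars` minus the eight `(a, b + 128)`, `a < 128`. [folklore] -/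
theorem oddChars_eq_filter : oddChars = chars.filter (fun ab => ab.2 < 128 ∨ 128 ≤ ab.1) := by decide

theorem oddChars_subset_chars : oddChars ⊆ chars := by
  rw [oddChars_eq_filter]; exact Finset.filter_subset _ _

/-- The eight first components (cosets `a + 2ℤ⁸`) of `oddChars`. [folklore] -/
def oddCosets : Finset ℕ := {30, 54, 86, 126, 158, 182, 214, 254}

theorem fst_mem_oddCosets : ∀ ab ∈ oddChars, ab.1 ∈ oddCosets := by decide

/-- **Repaired crux (recommended signature for the new item `OddThetaNullsR`).** For the 16 characteristics of
`oddChars` and every index `H`, the theta coefficient at the Cayley-reflected index is minus the coefficient at `H`: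
these 16 theta-nulls are odd in `z₅`. LOCAL STAND-IN for the route decl to be filed by the tenure planner.
[cite: FreitagHermann2000, §11 Thm. 11.5] -/
def OddThetaNullsR : Prop :=
  ∀ ab ∈ oddChars, ∀ H : Fin 6 → ℤ, thetaCoeff ab.1 ab.2 (flipQ H) = -thetaCoeff ab.1 ab.2 H

/-- **Stub 1 statement — count symmetry (the arithmetic heart).** On each of the eight cosets the number of
representations of `H` by `(Q₀,…,Q₅)` equals that of `flipQ H`. [cite: FreitagHermann2000, §11 Lemma 11.2] -/
def CountFlip : Prop :=
  ∀ a ∈ oddCosets, ∀ H : Fin 6 → ℤ, (bucket a (flipQ H)).card = (bucket a H).card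

/-- **Stub 2 statement — sign anti-alignment (elementary congruences).** For the 16 characteristics the sign
`(-1)^{b·m}` of any index in `bucket a (flipQ H)` is minus that of any index in `bucket a H` (pointwise:
`termSign b m = κ_a χ₄(Q₅(y)/32) [(-1)^{m₀}]`, `y = 2m + a`). [cite: MumfordTata1, Ch. II §1] -/
def SignFlip : Prop :=
  ∀ ab ∈ oddChars, ∀ H : Fin 6 → ℤ, ∀ m ∈ bucket ab.1 H, ∀ m' ∈ bucket ab.1 (flipQ H),
    termSign ab.2 m' = -termSign ab.2 m

/-- Stub 1: count symmetry of the coset representation numbers under the Cayley reflection.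
[cite: FreitagHermann2000, §11 Lemma 11.2] -/
theorem stub_countFlip : CountFlip := by
  sorry

/-- Stub 2: the theta signs are constant on buckets and flip with `H₅`. [cite: MumfordTata1, Ch. II §1] -/
theorem stub_signFlip : SignFlip := by
  sorry

/-- **Composition (real proof).** Count symmetry and sign anti-alignment give the repaired crux.
[cite: FreitagHermann2000, §11 Thm. 11.5] -/
theorem OddThetaNullsR_of_pieces (h₁ : CountFlip) (h₂ : SignFlip) : OddThetaNullsR := by
  intro ab hab H
  have hcard : (bucket ab.1 (flipQ H)).card = (bucket ab.1 H).card := h₁ ab.1 (fst_mem_oddCosets ab hab) H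
  simp only [thetaCoeff]
  by_cases hne : (bucket ab.1 H).Nonempty
  · obtain ⟨m₀, hm₀⟩ := hne
    have hflip : ∀ m' ∈ bucket ab.1 (flipQ H), termSign ab.2 m' = -termSign ab.2 m₀ :=
      fun m' hm' => h₂ ab hab H m₀ hm₀ m' hm'
    have hne' : (bucket ab.1 (flipQ H)).Nonempty := by
      rw [← Finset.card_pos, hcard, Finset.card_pos]
      exact ⟨m₀, hm₀⟩
    obtain ⟨m₁, hm₁⟩ := hne'
    have hconst : ∀ m ∈ bucket ab.1 H, termSign ab.2 m = termSign ab.2 m₀ := by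
      intro m hm
      have e1 := h₂ ab hab H m hm m₁ hm₁
      have e0 := h₂ ab hab H m₀ hm₀ m₁ hm₁
      linarith
    rw [Finset.sum_congr rfl hflip, Finset.sum_congr rfl hconst, Finset.sum_const, Finset.sum_const, hcard,
      smul_neg]
  · have h0 : bucket ab.1 H = ∅ := Finset.not_nonempty_iff_eq_empty.mp hne
    have h0' : bucket ab.1 (flipQ H) = ∅ := by
      rw [← Finset.card_eq_zero, hcard, Finset.card_eq_zero]
      exact h0
    simp [h0, h0']

/-- **THE SKELETON THEOREM** for the repaired crux, fed by the two declared stubs (the file's only `sorry`s). -/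
theorem OddThetaNullsR_of : OddThetaNullsR :=
  OddThetaNullsR_of_pieces stub_countFlip stub_signFlip

/-! ### Sorry-free sanity -/

/-- The repaired statement is a restriction of the refuted one (so every shell check done for the 24 covers it).
[folklore] -/
theorem oddThetaNullsR_of_oddThetaNulls (h : OddThetaNulls) : OddThetaNullsR :=
  fun ab hab H => h ab (oddChars_subset_chars hab) H

/-- Lowest-shell instance of `CountFlip` and `SignFlip` together (kernel-decided): on the coset `a = 30` the two
flipped buckets at `H = (20,-4,-16,-16,0,±32)` have two elements each and opposite constant signs for `b = 120`.
[folklore] -/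
theorem rung_lowest_shell :
    (bucket 30 ![20, -4, -16, -16, 0, 32]).card = 2 ∧ (bucket 30 ![20, -4, -16, -16, 0, -32]).card = 2 ∧
      thetaCoeff 30 120 ![20, -4, -16, -16, 0, 32] = 2 ∧ thetaCoeff 30 120 ![20, -4, -16, -16, 0, -32] = -2 := by
  refine ⟨by decide, by decide, thetaCoeff_example.1, thetaCoeff_example.2⟩

end Summit.HodgeConjecture.HodgeConjecture.Cruxes.OddThetaNulls.BirthR
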